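import Summits.PneNP.PneNP.Theorems.OneSliceShallowSliceBoundForcingWindow
import Summits.PneNP.PneNP.Theorems.OneSliceShallowSliceBoundPlanted
import Summits.PneNP.PneNP.Theorems.OneSliceShallowSliceBoundSprinkle
import Summits.PneNP.PneNP.Theorems.OneSliceShallowSliceBoundSlices
import Literature.Computability.Complexity.RossmanMonotoneCliqueThm2Proofs

/-!
# Route OneSlice, item `ShallowSliceBound` (stmt-PneNP-14083): forcing up (Leg A)

Helper file (prover seat, 2026-08-16), def-free. **Leg A** of the proof of `ShallowSliceBound` (`forcing_up`): for
`k ≥ 5`, `4c < k` and `η > 0` there are `θ, δ > 0` such that, eventually in `n`, for every central `j` and every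
circuit `C` over `{∧₂, ∨₂, 0, 1}` with at most `n^c` gates that errs against `k`-CLIQUE on at most `δ · #slice_j`
graphs of the slice `j`, the circuit accepts at least a `(1 - η)`-fraction of EVERY slice `t` with
`j + j^{1-θ} ≤ t ≤ C(n,2)`.

Proof: with `j' = j - C(k,2)`, a pair `(H, A)` (`H` on slice `j'`, `A` a `k`-set) with `C(H ⊔ K_A) = 0` is either
overlapping (few, `…Planted.lean`) or — being an error of `C` weighted by `ω_k` — controlled by Cauchy–Schwarz and the
slice second moment (`…Planted.lean`); by Markov most `H` have `Pr_A[C(H ⊔ K_A) = 1] ≥ 1/2`, so Rossman's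
Theorem 1 (`thm1_finite`, tree-proved, at `δ₁ = k⁻³`, `c₀ = 2`, `η = 1/2`) applied to the restriction `C^H`
(`Circuit.exists_restrict_sup`) gives `Pr_{G⁻}[C(H ⊔ G⁻) = 1] ≥ 1 - exp(-n^{c'})`, `G⁻ ∼ G(n, n^{-2(1+δ₁)/(k-1)})`.
The law of `H ⊔ G⁻` is a mixture of uniform slices (`…Sprinkle.lean`), the sprinkle adds fewer than `j^{1-θ}` edges
except with probability `o(1)` (Markov, `θ = δ₁/(2(k-1))`), and the slice acceptance of the monotone `C` is
non-decreasing in the slice (`…Slices.lean`): hence `a_t(C) ≥ 1 - η`. [cite: Rossman2010, Thm 1 (p. 4), §7]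
-/

set_option linter.dupNamespace false

noncomputable section

namespace Summit.PneNP.PneNP.Theorems.ShallowSliceBound

open Finset Filter Literature.Computability.Complexity Classical
open Summit.PneNP.PneNP.Theorems.ConstantBand.Negative (Edge thr Central slice errSet)
open Summit.PneNP.PneNP.Cruxes.ConstantBand.FlatPriorRelativeMinterms (ts_mem_slice ts_card_slice_pos ts_mem_errSet)
open Summit.PneNP.PneNP.Cruxes.SliceACZero.RussoWindowLadder (wt sliceAvg)
open scoped Topology

variable {n : ℕ}

/-- The slice of `LoadBearing.lean` is the weight slice of the general cube vocabulary (`edgeCount = wt`). [folklore] -/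
theorem slice_eq_filter_wt (n i : ℕ) : slice n i = univ.filter fun x : Edge n → Bool => wt x = i := rfl

/-- Acceptance counts: `(slice n t).filter (f = 1) = {x : wt x = t ∧ f x = 1}`. [folklore] -/
theorem filter_slice_eq (n t : ℕ) (f : (Edge n → Bool) → Bool) :
    (slice n t).filter (fun x => f x = true) = univ.filter fun x : Edge n → Bool => wt x = t ∧ f x = true := by
  rw [slice_eq_filter_wt, filter_filter]

/-- **The planted acceptance lemma** (finite form, all parameters explicit): for `f` monotone... see `forcing_up`.
For `k ≥ 2`, `2k ≤ n`, `1 ≤ n`, `j = j' + K` (`K = C(k,2)`), `K ≤ j'`, `j ≤ C(n,2)`, densities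
`j/C(n,2) ≤ 2 n^{-2/(k-1)}` and `(1/8) n^{-2/(k-1)} ≤ j'/C(n,2)`, and `#err_j(f) ≤ δ #slice_j`, the `H` on slice `j'`
with fewer than half of the `A` accepted number at most `(2 K j'/C(n,2) + 2 √(δ B)) #slice_{j'}`,
`B = (1 + k 2^k 2^K) (2^K 2^k k! 8^K)`. [folklore] -/
theorem card_badH_le {k j' : ℕ} (hk : 2 ≤ k) (hkn : 2 * k ≤ n) (hKj' : k.choose 2 ≤ j')
    (hjN : j' + k.choose 2 ≤ n.choose 2)
    (hjb : ((j' + k.choose 2 : ℕ) : ℝ) / (n.choose 2 : ℕ) ≤ 2 * (n : ℝ) ^ (-(2 : ℝ) / ((k : ℝ) - 1)))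
    (hja : (1 / 8 : ℝ) * (n : ℝ) ^ (-(2 : ℝ) / ((k : ℝ) - 1)) ≤ (j' : ℝ) / (n.choose 2 : ℕ))
    (C : Circuit (Edge n)) {δ : ℝ} (hδ : 0 ≤ δ)
    (herr : (#(errSet n k (j' + k.choose 2) C) : ℝ) ≤ δ * #(slice n (j' + k.choose 2))) :
    (#((slice n j').filter fun H => 2 * #((powersetCard k (univ : Finset (Fin n))).filter
        fun A => C.eval (H ⊔ cliqueVec A) = true) < n.choose k) : ℝ) ≤
      (2 * k.choose 2 * j' / (n.choose 2 : ℕ) +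
        2 * Real.sqrt (δ * ((1 + k * 2 ^ k * (2 : ℝ) ^ k.choose 2) *
          ((2 : ℝ) ^ k.choose 2 * 2 ^ k * k.factorial * 8 ^ k.choose 2)))) * #(slice n j') := by
  set K := k.choose 2 with hK
  set j := j' + K with hj
  set N := n.choose 2 with hN
  set 𝒜 := powersetCard k (univ : Finset (Fin n)) with h𝒜
  set S' := slice n j' with hS'
  set B₁ : ℝ := 1 + k * 2 ^ k * (2 : ℝ) ^ K with hB₁
  set B₂ : ℝ := (2 : ℝ) ^ K * 2 ^ k * k.factorial * 8 ^ K with hB₂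
  have hn1 : 1 ≤ n := by omega
  have hNpos : 0 < N := by rw [hN]; exact Nat.choose_pos (by omega)
  have hNr : (0 : ℝ) < N := by exact_mod_cast hNpos
  have hj'N : j' ≤ N := by omega
  have hθ0 : 0 < (n : ℝ) ^ (-(2 : ℝ) / ((k : ℝ) - 1)) := Real.rpow_pos_of_pos (by exact_mod_cast hn1) _
  have hj'pos : (0 : ℝ) < j' := by
    have : (0 : ℝ) < (j' : ℝ) / N := lt_of_lt_of_le (by positivity) hja
    exact (div_pos_iff_of_pos_right hNr).1 this
  have hCnk : 0 < n.choose k := Nat.choose_pos (by omega)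
  have hCnkr : (0 : ℝ) < n.choose k := by exact_mod_cast hCnk
  have hS'pos : (0 : ℝ) < #S' := by exact_mod_cast ts_card_slice_pos hj'N
  -- the three sets of pairs
  set bad := (S' ×ˢ 𝒜).filter fun p => C.eval (p.1 ⊔ cliqueVec p.2) = false with hbad
  set nd := (S' ×ˢ 𝒜).filter fun p => ∃ e, p.1 e = true ∧ cliqueVec p.2 e = true with hnd
  set dj := (S' ×ˢ 𝒜).filter fun p =>
    (∀ e, ¬ (p.1 e = true ∧ cliqueVec p.2 e = true)) ∧ C.eval (p.1 ⊔ cliqueVec p.2) = false with hdj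
  have hsplit : #bad ≤ #nd + #dj := by
    refine (card_le_card fun p hp => ?_).trans (card_union_le nd dj)
    rw [hbad, mem_filter] at hp
    rw [mem_union, hnd, hdj, mem_filter, mem_filter]
    by_cases h : ∃ e, p.1 e = true ∧ cliqueVec p.2 e = true
    · exact Or.inl ⟨hp.1, h⟩
    · push Not at h
      exact Or.inr ⟨hp.1, fun e he => h e he.1 he.2, hp.2⟩
  -- overlapping pairs
  have hnd_le : (#nd : ℝ) ≤ (n.choose k : ℝ) * K * j' / N * #S' := by
    have := card_overlap_pairs_mul_le k j' hj'N (n := n)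
    rw [← hnd, ← hS'] at this
    have h' : (#nd : ℝ) * N ≤ (n.choose k : ℝ) * K * j' * #S' := by exact_mod_cast this
    rw [div_mul_eq_mul_div, le_div_iff₀ hNr]
    linarith
  -- disjoint rejected pairs: Cauchy–Schwarz and the second moment
  have hdj_sq : (#dj : ℝ) ^ 2 ≤ δ * #(slice n j) * (#(slice n j) * ((n.choose k : ℝ) * ((j : ℝ) / N) ^ K * B₁)) := by
    have h1 := card_disjoint_bad_pairs_le C.eval k j' (n := n)
    rw [← hdj, ← hK, ← hj] at h1
    have h2 := sum_cliqueCount_sq_le_card_mul C.eval k j (n := n)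
    have h3 : (#((slice n j).filter fun x => C.eval x = false ∧ cliqueCount n k x ≠ 0) : ℝ) ≤ δ * #(slice n j) := by
      refine le_trans ?_ herr
      have : (slice n j).filter (fun x => C.eval x = false ∧ cliqueCount n k x ≠ 0) ⊆ errSet n k j C := by
        intro x hx
        rw [mem_filter, ts_mem_slice] at hx
        rw [ts_mem_errSet]
        refine ⟨hx.1, ?_⟩
        rw [hx.2.1, (cliqueCount_ne_zero_iff x).1 hx.2.2]
        decide
      exact_mod_cast card_le_card this
    have h4 := sum_cliqueCount_sq_le (k := k) (n := n) (j := j) hjN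
    have h5 : ∑ A ∈ 𝒜, ∑ B ∈ 𝒜, ((j : ℝ) / N) ^ (2 * K - (#(A ∩ B)).choose 2) ≤
        (n.choose k : ℝ) * ((j : ℝ) / N) ^ K * B₁ :=
      sum_sum_pow_inter_le hk hn1 (by positivity) (by norm_num) (by rw [hj]; exact hjb)
    have hsq0 : (0 : ℝ) ≤ ∑ x ∈ slice n j, (cliqueCount n k x : ℝ) ^ 2 := sum_nonneg fun _ _ => sq_nonneg _
    calc (#dj : ℝ) ^ 2 ≤ ((∑ x ∈ (slice n j).filter (fun x => C.eval x = false), cliqueCount n k x : ℕ) : ℝ) ^ 2 := by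
          exact pow_le_pow_left₀ (Nat.cast_nonneg _) (by exact_mod_cast h1) 2
      _ ≤ #((slice n j).filter fun x => C.eval x = false ∧ cliqueCount n k x ≠ 0) *
            ∑ x ∈ slice n j, (cliqueCount n k x : ℝ) ^ 2 := h2
      _ ≤ δ * #(slice n j) * ∑ x ∈ slice n j, (cliqueCount n k x : ℝ) ^ 2 := mul_le_mul_of_nonneg_right h3 hsq0
      _ ≤ δ * #(slice n j) * (#(slice n j) * ((n.choose k : ℝ) * ((j : ℝ) / N) ^ K * B₁)) := by
          refine mul_le_mul_of_nonneg_left (h4.trans (mul_le_mul_of_nonneg_left h5 (Nat.cast_nonneg _))) ?_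
          positivity
  -- ratio of slice sizes and the lower bound on the planted first moment
  have hratio : (#(slice n j) : ℝ) * (j' : ℝ) ^ K ≤ #S' * (N : ℝ) ^ K := by
    have := card_slice_add_mul_pow_le n j' K
    rw [← hj, ← hS'] at this
    exact this
  have hμ : (1 / 8 : ℝ) ^ K / (2 ^ k * k.factorial) ≤ (n.choose k : ℝ) * ((j' : ℝ) / N) ^ K := by
    refine (le_choose_mul_threshold_pow hk hkn (by norm_num : (0 : ℝ) ≤ 1 / 8)).trans ?_
    exact mul_le_mul_of_nonneg_left (pow_le_pow_left₀ (by positivity) hja K) (Nat.cast_nonneg _)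
  -- `#dj ≤ √(δ B₁ B₂) #S' C(n,k)`
  have hdj_le : (#dj : ℝ) ≤ Real.sqrt (δ * (B₁ * B₂)) * #S' * (n.choose k : ℝ) := by
    have hB₂0 : 0 < B₂ := by positivity
    have hB₁0 : 0 < B₁ := by positivity
    -- `(j/j')^K ≤ 2^K`
    have hjj' : (j : ℝ) ≤ 2 * j' := by
      rw [hj]; push_cast
      have : (K : ℝ) ≤ j' := by exact_mod_cast hKj'
      linarith
    have hjK : (j : ℝ) ^ K ≤ (2 : ℝ) ^ K * (j' : ℝ) ^ K := by
      rw [← mul_pow]; exact pow_le_pow_left₀ (by positivity) hjj' K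
    -- square both sides
    have hR0 : 0 ≤ Real.sqrt (δ * (B₁ * B₂)) * #S' * (n.choose k : ℝ) := by positivity
    rw [← pow_le_pow_iff_left₀ (Nat.cast_nonneg _) hR0 two_ne_zero, mul_pow, mul_pow, Real.sq_sqrt (by positivity)]
    refine hdj_sq.trans ?_
    -- `N^K ≤ 8^K 2^k k! · C(n,k) j'^K` (the first-moment lower bound, product form)
    have hμN : (N : ℝ) ^ K ≤ (8 : ℝ) ^ K * (2 ^ k * k.factorial) * ((n.choose k : ℝ) * (j' : ℝ) ^ K) := by
      have hNK : (0 : ℝ) < (N : ℝ) ^ K := pow_pos hNr K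
      have hM : (0 : ℝ) < 2 ^ k * k.factorial := by positivity
      have e1 : ((8 : ℝ) ^ K * (2 ^ k * k.factorial)) * ((1 / 8 : ℝ) ^ K / (2 ^ k * k.factorial)) = 1 := by
        calc ((8 : ℝ) ^ K * (2 ^ k * k.factorial)) * ((1 / 8 : ℝ) ^ K / (2 ^ k * k.factorial))
            = ((8 : ℝ) * (1 / 8)) ^ K * ((2 ^ k * k.factorial) / (2 ^ k * k.factorial)) := by rw [mul_pow]; ring
          _ = 1 := by rw [div_self hM.ne']; norm_num
      have e2 : ((j' : ℝ) / N) ^ K * (N : ℝ) ^ K = (j' : ℝ) ^ K := by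
        rw [div_pow, div_mul_cancel₀ _ hNK.ne']
      calc (N : ℝ) ^ K = ((8 : ℝ) ^ K * (2 ^ k * k.factorial)) * ((1 / 8 : ℝ) ^ K / (2 ^ k * k.factorial)) * (N : ℝ) ^ K := by
            rw [e1, one_mul]
        _ ≤ ((8 : ℝ) ^ K * (2 ^ k * k.factorial)) * ((n.choose k : ℝ) * ((j' : ℝ) / N) ^ K) * (N : ℝ) ^ K := by
            gcongr
        _ = (8 : ℝ) ^ K * (2 ^ k * k.factorial) * ((n.choose k : ℝ) * (((j' : ℝ) / N) ^ K * (N : ℝ) ^ K)) := by ring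
        _ = (8 : ℝ) ^ K * (2 ^ k * k.factorial) * ((n.choose k : ℝ) * (j' : ℝ) ^ K) := by rw [e2]
    -- reduce to `#slice_j² C(n,k) j^K ≤ B₂ #S'² C(n,k)² N^K` (cancel `j'^K`)
    have hX0 : (0 : ℝ) ≤ #(slice n j) := Nat.cast_nonneg _
    have hkey' : (#(slice n j) : ℝ) ^ 2 * (n.choose k : ℝ) * (j : ℝ) ^ K ≤
        B₂ * (#S' : ℝ) ^ 2 * (n.choose k : ℝ) ^ 2 * (N : ℝ) ^ K := by
      refine le_of_mul_le_mul_right ?_ (pow_pos hj'pos K)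
      calc (#(slice n j) : ℝ) ^ 2 * (n.choose k : ℝ) * (j : ℝ) ^ K * (j' : ℝ) ^ K
          ≤ (#(slice n j) : ℝ) ^ 2 * (n.choose k : ℝ) * ((2 : ℝ) ^ K * (j' : ℝ) ^ K) * (j' : ℝ) ^ K := by gcongr
        _ = (2 : ℝ) ^ K * (n.choose k : ℝ) * ((#(slice n j) : ℝ) * (j' : ℝ) ^ K) ^ 2 := by ring
        _ ≤ (2 : ℝ) ^ K * (n.choose k : ℝ) * ((#S' : ℝ) * (N : ℝ) ^ K) ^ 2 := by
            gcongr
        _ = (2 : ℝ) ^ K * (n.choose k : ℝ) * (#S' : ℝ) ^ 2 * (N : ℝ) ^ K * (N : ℝ) ^ K := by ring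
        _ ≤ (2 : ℝ) ^ K * (n.choose k : ℝ) * (#S' : ℝ) ^ 2 * (N : ℝ) ^ K *
            ((8 : ℝ) ^ K * (2 ^ k * k.factorial) * ((n.choose k : ℝ) * (j' : ℝ) ^ K)) := by gcongr
        _ = B₂ * (#S' : ℝ) ^ 2 * (n.choose k : ℝ) ^ 2 * (N : ℝ) ^ K * (j' : ℝ) ^ K := by rw [hB₂]; ring
    have hkey : (#(slice n j) : ℝ) ^ 2 * ((n.choose k : ℝ) * ((j : ℝ) / N) ^ K) ≤
        B₂ * (#S' : ℝ) ^ 2 * (n.choose k : ℝ) ^ 2 := by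
      rw [div_pow, show (#(slice n j) : ℝ) ^ 2 * ((n.choose k : ℝ) * ((j : ℝ) ^ K / (N : ℝ) ^ K)) =
        (#(slice n j) : ℝ) ^ 2 * (n.choose k : ℝ) * (j : ℝ) ^ K / (N : ℝ) ^ K by ring, div_le_iff₀ (pow_pos hNr K)]
      exact hkey'
    calc δ * #(slice n j) * (#(slice n j) * ((n.choose k : ℝ) * ((j : ℝ) / N) ^ K * B₁))
        = δ * B₁ * ((#(slice n j) : ℝ) ^ 2 * ((n.choose k : ℝ) * ((j : ℝ) / N) ^ K)) := by ring
      _ ≤ δ * B₁ * (B₂ * (#S' : ℝ) ^ 2 * (n.choose k : ℝ) ^ 2) := mul_le_mul_of_nonneg_left hkey (by positivity)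
      _ = δ * (B₁ * B₂) * (#S' : ℝ) ^ 2 * (n.choose k : ℝ) ^ 2 := by ring
  -- Markov over `H`
  have hmarkov := card_badH_mul_le C.eval k j' (n := n)
  rw [← h𝒜, ← hS', ← hbad] at hmarkov
  have hmarkovR : (#(S'.filter fun H => 2 * #(𝒜.filter fun A => C.eval (H ⊔ cliqueVec A) = true) < n.choose k) : ℝ) *
      (n.choose k : ℝ) ≤ 2 * #bad := by exact_mod_cast hmarkov
  have hbadR : (#bad : ℝ) ≤ #nd + #dj := by exact_mod_cast hsplit
  rw [← le_div_iff₀ hCnkr] at hmarkovR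
  refine hmarkovR.trans ?_
  rw [div_le_iff₀ hCnkr]
  have := add_le_add hnd_le hdj_le
  calc 2 * (#bad : ℝ) ≤ 2 * ((n.choose k : ℝ) * K * j' / N * #S' + Real.sqrt (δ * (B₁ * B₂)) * #S' * (n.choose k : ℝ)) := by
        linarith
    _ = _ := by rw [hB₁, hB₂]; ring

/-- **Registered form** (sub-goal `planted_badH_le` of stmt-PneNP-14083): `card_badH_le` with all binders explicit.
[folklore] -/
theorem planted_badH_le :
    ∀ (n k j' : ℕ), 2 ≤ k → 2 * k ≤ n → k.choose 2 ≤ j' → j' + k.choose 2 ≤ n.choose 2 →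
      ((j' + k.choose 2 : ℕ) : ℝ) / (n.choose 2 : ℕ) ≤ 2 * (n : ℝ) ^ (-(2 : ℝ) / ((k : ℝ) - 1)) →
      (1 / 8 : ℝ) * (n : ℝ) ^ (-(2 : ℝ) / ((k : ℝ) - 1)) ≤ (j' : ℝ) / (n.choose 2 : ℕ) →
      ∀ (C : Circuit (Edge n)) (δ : ℝ), 0 ≤ δ →
      (#(errSet n k (j' + k.choose 2) C) : ℝ) ≤ δ * #(slice n (j' + k.choose 2)) →
      (#((slice n j').filter fun H => 2 * #((powersetCard k (univ : Finset (Fin n))).filter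
        fun A => C.eval (H ⊔ cliqueVec A) = true) < n.choose k) : ℝ) ≤
      (2 * k.choose 2 * j' / (n.choose 2 : ℕ) +
        2 * Real.sqrt (δ * ((1 + k * 2 ^ k * (2 : ℝ) ^ k.choose 2) *
          ((2 : ℝ) ^ k.choose 2 * 2 ^ k * k.factorial * 8 ^ k.choose 2)))) * #(slice n j') :=
  fun _ _ _ hk hkn hKj' hjN hjb hja C _ hδ herr => card_badH_le hk hkn hKj' hjN hjb hja C hδ herr

end Summit.PneNP.PneNP.Theorems.ShallowSliceBound

end
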